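import Summits.QuantumFields.BalabanUV.Gaps.D4WalkBlockLocal
import Summits.QuantumFields.BalabanUV.T4Continuum.Spine.NE5.TwoRunPencilDomains

/-!
# Spine/NE5/TwoRunPencilDomainsBlock — the (x4) pencil of domain-localised data in the BLOCK currency: `IsDomainLocalB` along the
# pencil with the operator-norm letter `λ ↦ λ(1 + τr)` (cell `pub-balaban-gaps`, seat `ne5` gen 6; block twin of `TwoRunPencilDomains`)

Over g1-p2's `Gaps/D4WalkBlockLocal.IsDomainLocalB` (the base objects of the V47-repaired NODE-O calculus: blocks of `F_b(u)` vanish off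
`dom b × dom b`, `‖F_b(u)‖_{y,y′} ≤ λ` in OPERATOR norm) and this seat's `TwoRunPencilDomains.withOp` (shared skeleton, coefficients
replaced): run A `IsDomainLocalB`, run B's coefficients (on run A's term index) block-supported in the same domains, entries holomorphic
on the same ball, BLOCK-close at the local two-run rate `‖opB b u − op b u‖_{y,y′} ≤ r_AB·λ` ⟹ every pencil datum
`withOp L (op + t(opB − op))`, `‖t‖ ≤ τ`, is `IsDomainLocalB` with `λ(1 + τr_AB)`, every other letter unchanged
(`isDomainLocalB_withOp_pencil`; reach form `_reach`) — so `blockWalkExpansion_domainLocal` covers the whole pencil with one package.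
HONEST FRAMING.  Bookkeeping (subadditivity ∕ homogeneity of the block norm); nothing of Bałaban's constructed; NE5 NOT PRINTED ∕ NOT
PROVED; (D4) 0∕1; 0∕12 leaves; words UNCHANGED; NOT continuum, NOT mass gap, NOT Clay.  0 sorry, 0 `def`.
Sources: [B9] CMP **99** (1985) [Balaban1985BackgroundPropagators] (3.87)–(3.89) p. 409, Thm 3.10 p. 416; [II] CMP **116** (1988)
[Balaban1988RG2Cluster] (1.5) p. 3, (1.11) p. 5, p. 15.
-/

noncomputable section

namespace Summit.QuantumFields.BalabanUV.T4Continuum.Spine.NE5.TwoRunPencilDomainsBlock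

open Metric Set Finset
open Literature.MathematicalPhysics.QuantumFieldTheory.Balaban1983to89
open Literature.MathematicalPhysics.QuantumFieldTheory.Balaban1983to89.B5TorusCover (UT)
open Literature.MathematicalPhysics.QuantumFieldTheory.Balaban1983to89.B13DomainKernelWalks (DomainTerms)
open Summit.QuantumFields.BalabanUV.Gaps.D4WalkBlock (blockNorm blockNorm_nonneg blockNorm_add_le blockNorm_smul_le)
open Summit.QuantumFields.BalabanUV.Gaps.D4WalkBlockLocal (IsDomainLocalB)
open Summit.QuantumFields.BalabanUV.T4Continuum.Spine.NE5.TwoRunPencilDomains (withOp)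

variable {d N' : ℕ} {ν : ℕ} {K : Fin ν → ℕ} [∀ i, NeZero (K i)]
variable {p n : Type} [Fintype p] [Fintype n]
variable {E : Type*} [NormedAddCommGroup E] [NormedSpace ℂ E]
variable {L : DomainTerms d N' ν K p n E}
variable {c : B13.Consts} {cub : p → UT K} {cubn : n → UT K} {X : Finset (UT K)} {R lam r : ℝ} {mJ nD : ℕ}

omit [∀ i, NeZero (K i)] in
/-- Blocks of a pencil vanish where both runs' blocks vanish. [cite: Balaban1985BackgroundPropagators, (3.89) p.409] (elementary API) -/
theorem blockNorm_pencil_eq_zero {MA MB : Matrix p n ℂ} (t : ℂ) {y y' : UT K} (hA : blockNorm cub cubn MA y y' = 0)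
    (hB : blockNorm cub cubn MB y y' = 0) : blockNorm cub cubn (MA + t • (MB - MA)) y y' = 0 := by
  refine le_antisymm ?_ (blockNorm_nonneg cub cubn _ y y')
  have hsub : blockNorm cub cubn (MB - MA) y y' ≤ 0 := by
    rw [sub_eq_add_neg, ← neg_one_smul ℂ MA]
    calc blockNorm cub cubn (MB + (-1 : ℂ) • MA) y y'
        ≤ blockNorm cub cubn MB y y' + blockNorm cub cubn ((-1 : ℂ) • MA) y y' := blockNorm_add_le cub cubn _ _ y y'
      _ ≤ 0 + ‖(-1 : ℂ)‖ * blockNorm cub cubn MA y y' := add_le_add hB.le (blockNorm_smul_le cub cubn _ _ y y')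
      _ = 0 := by rw [hA]; simp
  calc blockNorm cub cubn (MA + t • (MB - MA)) y y'
      ≤ blockNorm cub cubn MA y y' + blockNorm cub cubn (t • (MB - MA)) y y' := blockNorm_add_le cub cubn _ _ y y'
    _ ≤ 0 + ‖t‖ * blockNorm cub cubn (MB - MA) y y' := add_le_add hA.le (blockNorm_smul_le cub cubn t _ y y')
    _ ≤ 0 + ‖t‖ * 0 := by gcongr
    _ = 0 := by ring

/-- **THE PENCIL OF BLOCK-LOCAL DATA IS BLOCK-LOCAL, `λ ↦ λ(1 + τr_AB)`.** [cite: Balaban1985BackgroundPropagators, (3.87)–(3.89) p.409, Thm 3.10 p.416; Balaban1988RG2Cluster, (1.5) p.3, p.15] -/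
theorem isDomainLocalB_withOp_pencil (hL : IsDomainLocalB L c cub cubn X R lam r mJ nD)
    {opB : L.B → E → Matrix p n ℂ}
    (hsuppB : ∀ b u y y', blockNorm cub cubn (opB b u) y y' ≠ 0 → y ∈ L.dom b ∧ y' ∈ L.dom b)
    (hanB : ∀ b i j, DifferentiableOn ℂ (fun u => opB b u i j) (ball (0 : E) R))
    {rAB τ : ℝ} (hτ : 0 ≤ τ)
    (hdiffB : ∀ b, ∀ u ∈ ball (0 : E) R, ∀ y y', blockNorm cub cubn (opB b u - L.op b u) y y' ≤ rAB * lam)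
    {t : ℂ} (ht : ‖t‖ ≤ τ) :
    IsDomainLocalB (withOp L fun b u => L.op b u + t • (opB b u - L.op b u)) c cub cubn X R ((1 + τ * rAB) * lam) r mJ nD where
  hanchor := hL.hanchor
  hsuppB b u y y' hne := by
    by_contra hout
    have hA : blockNorm cub cubn (L.op b u) y y' = 0 := by
      by_contra h; exact hout (hL.hsuppB b u y y' h)
    have hB : blockNorm cub cubn (opB b u) y y' = 0 := by
      by_contra h; exact hout (hsuppB b u y y' h)
    exact hne (blockNorm_pencil_eq_zero t hA hB)
  han b i j := by
    show DifferentiableOn ℂ (fun u => (L.op b u + t • (opB b u - L.op b u)) i j) (ball (0 : E) R)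
    simp only [Matrix.add_apply, Matrix.smul_apply, Matrix.sub_apply, smul_eq_mul]
    exact (hL.han b i j).add (((hanB b i j).sub (hL.han b i j)).const_mul t)
  hbdB b u hu y y' := by
    show blockNorm cub cubn (L.op b u + t • (opB b u - L.op b u)) y y' ≤ (1 + τ * rAB) * lam
    calc blockNorm cub cubn (L.op b u + t • (opB b u - L.op b u)) y y'
        ≤ blockNorm cub cubn (L.op b u) y y' + blockNorm cub cubn (t • (opB b u - L.op b u)) y y' :=
          blockNorm_add_le cub cubn _ _ y y'
      _ ≤ lam + ‖t‖ * blockNorm cub cubn (opB b u - L.op b u) y y' :=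
          add_le_add (hL.hbdB b u hu y y') (blockNorm_smul_le cub cubn t _ y y')
      _ ≤ lam + τ * (rAB * lam) :=
          add_le_add_right (mul_le_mul ht (hdiffB b u hu y y') (blockNorm_nonneg cub cubn _ y y') hτ) lam
      _ = (1 + τ * rAB) * lam := by ring
  hdiam := hL.hdiam
  hJ := hL.hJ
  hX := hL.hX
  hmult := hL.hmult

/-- **Reach form** (`τ = s∕r_AB`): the letter is `λ(1 + s)`, independent of the rate. [cite: Balaban1985BackgroundPropagators, Thm 3.10 p.416] -/
theorem isDomainLocalB_withOp_pencil_reach (hL : IsDomainLocalB L c cub cubn X R lam r mJ nD)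
    {opB : L.B → E → Matrix p n ℂ}
    (hsuppB : ∀ b u y y', blockNorm cub cubn (opB b u) y y' ≠ 0 → y ∈ L.dom b ∧ y' ∈ L.dom b)
    (hanB : ∀ b i j, DifferentiableOn ℂ (fun u => opB b u i j) (ball (0 : E) R))
    {rAB s : ℝ} (hr : 0 < rAB) (hs : 0 ≤ s)
    (hdiffB : ∀ b, ∀ u ∈ ball (0 : E) R, ∀ y y', blockNorm cub cubn (opB b u - L.op b u) y y' ≤ rAB * lam)
    {t : ℂ} (ht : ‖t‖ ≤ s / rAB) :
    IsDomainLocalB (withOp L fun b u => L.op b u + t • (opB b u - L.op b u)) c cub cubn X R ((1 + s) * lam) r mJ nD := by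
  have hsr : 1 + s / rAB * rAB = 1 + s := by rw [div_mul_cancel₀ s hr.ne']
  simpa only [hsr] using isDomainLocalB_withOp_pencil hL hsuppB hanB (div_nonneg hs hr.le) hdiffB ht

end Summit.QuantumFields.BalabanUV.T4Continuum.Spine.NE5.TwoRunPencilDomainsBlock

end
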